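import Summits.Ventures.PercRepro.C041CutGlueBound

/-!
# LEMMA G with a layered gadget: the O-cube sum is a sum of glue identities over the layers (p6, gen 25;
C-041.md §9)

In LEMMA G the gadget `𝒫` carries the openings `X ⊆ B(O)`: its states are the pairs `(X, τ)` of a layer and a
pattern of that layer, and the O-cube sum `𝒲 = Σ_{X ⊆ B(O)} F(O ∪ X)` of `G⁺ = 𝒫 ∪_{u″} Γ″` is the sum over the
layers of the single-layer pairings (the far side `Γ″` carries no opening, so it is the same in every layer).  This
file has that bookkeeping: the LAYERED SPACE `sigmaSpace P` of a family of spaces `P i` (states `⟨i, σ⟩`), and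

  **`phi_glue_sigma`**: `Φ(glue (sigmaSpace P) ρ₁ ρ₂ Q) = Σ_i Φ(glue (P i) (ρ₁ i) (ρ₂ i) Q)`,

so that LEMMA G's identity / bound / criterion for the layered gadget (`phi_glue`, `phi_glue_ge`,
`phi_glue_nonneg_of_star` applied to `sigmaSpace P`) govern the sum over the layers of the per-layer glues, and the
counts of the layered gadget are the sums of the per-layer counts (`cnt_sigma`, `phi_sigma`, `phiAll_sigma`,
`I_sigma`, `m₁_sigma`, `m₂_sigma`).  Combined with the single-layer pairing on zone port problems
(`C041CutSplitSum`), this is the abstract shape of the layered LEMMA G; the identification of the far sides of the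
layers (the same `Γ″` in every layer, up to the renaming of its terminal edges) is not typed.
-/

namespace PercRepro

namespace CutGlue

open Finset

variable {ι : Type*} {Y : ι → Type*}

/-- The layered space: states `⟨i, σ⟩`, a layer and a state of that layer. -/
def sigmaSpace (P : (i : ι) → Space (Y i)) : Space (Σ i, Y i) where
  w s := (P s.1).w s.2
  G₁ s := (P s.1).G₁ s.2
  G₂ s := (P s.1).G₂ s.2
  V s := (P s.1).V s.2
  hG₁ s h := (P s.1).hG₁ s.2 h
  hG₂ s h := (P s.1).hG₂ s.2 h

/-- The reach bits of the layered gadget from per-layer reach bits. -/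
def sigmaRho (ρ : (i : ι) → Y i → Prop) (s : Σ i, Y i) : Prop := ρ s.1 s.2

variable [Fintype ι] [∀ i, Fintype (Y i)]

open Classical in
/-- A count of the layered space is the sum of the per-layer counts. -/
theorem cnt_sigma (P : (i : ι) → Space (Y i)) (p : (i : ι) → Y i → Prop) :
    (sigmaSpace P).cnt (fun s => p s.1 s.2) = ∑ i, (P i).cnt (p i) := by
  unfold Space.cnt
  rw [Fintype.sum_sigma]
  rfl

/-- `Φ` of the layered space is the sum of the per-layer `Φ`. -/
theorem phi_sigma (P : (i : ι) → Space (Y i)) : (sigmaSpace P).phi = ∑ i, (P i).phi := by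
  unfold Space.phi
  rw [Fintype.sum_sigma]
  rfl

/-- `Φ_all` of the layered space is the sum of the per-layer `Φ_all`. -/
theorem phiAll_sigma (P : (i : ι) → Space (Y i)) : (sigmaSpace P).phiAll = ∑ i, (P i).phiAll := by
  unfold Space.phiAll
  rw [Fintype.sum_sigma]
  rfl

/-- `I` of the layered space is the sum of the per-layer `I`. -/
theorem I_sigma (P : (i : ι) → Space (Y i)) : (sigmaSpace P).I = ∑ i, (P i).I :=
  cnt_sigma P fun i σ => ¬ (P i).V σ

/-- `m₁` of the layered space is the sum of the per-layer `m₁`. -/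
theorem m₁_sigma (P : (i : ι) → Space (Y i)) (ρ : (i : ι) → Y i → Prop) :
    (sigmaSpace P).m₁ (sigmaRho ρ) = ∑ i, (P i).m₁ (ρ i) :=
  cnt_sigma P fun i σ => ¬ (P i).G₁ σ ∧ ρ i σ

/-- `m₂` of the layered space is the sum of the per-layer `m₂`. -/
theorem m₂_sigma (P : (i : ι) → Space (Y i)) (ρ : (i : ι) → Y i → Prop) :
    (sigmaSpace P).m₂ (sigmaRho ρ) = ∑ i, (P i).m₂ (ρ i) :=
  cnt_sigma P fun i σ => ¬ (P i).G₂ σ ∧ ρ i σ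

variable {X : Type*} [Fintype X]

open Classical in
/-- **The O-cube sum is the sum of the per-layer glues**: `Φ(glue (sigmaSpace P) ρ₁ ρ₂ Q) = Σ_i Φ(glue (P i)
(ρ₁ i) (ρ₂ i) Q)`. -/
theorem phi_glue_sigma (P : (i : ι) → Space (Y i)) (ρ₁ ρ₂ : (i : ι) → Y i → Prop) (Q : Space X) :
    (glue (sigmaSpace P) (sigmaRho ρ₁) (sigmaRho ρ₂) Q).phi = ∑ i, (glue (P i) (ρ₁ i) (ρ₂ i) Q).phi := by
  simp only [phi_glue, phiAll_sigma, m₁_sigma, m₂_sigma, phi_sigma]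
  rw [Finset.sum_add_distrib, Finset.sum_mul, ← Finset.sum_comm]
  congr 1
  rw [Finset.mul_sum]
  apply Finset.sum_congr rfl
  intro x _
  by_cases hx : Q.V x
  · simp only [if_pos hx]
    rw [Finset.sum_mul, Finset.mul_sum, Finset.sum_mul, ← Finset.sum_add_distrib, ← Finset.sum_add_distrib,
      Finset.mul_sum]
  · simp only [if_neg hx, Finset.sum_const_zero]

end CutGlue

end PercRepro
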